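import Literature.MathematicalPhysics.QuantumFieldTheory.Balaban1983to89.B8Ineq165Descent
import Literature.MathematicalPhysics.QuantumFieldTheory.Balaban1983to89.B8Eq115GaugeFixing
import Literature.MathematicalPhysics.QuantumFieldTheory.Balaban1983to89.B15Ineq183AxialGauge

/-!
# `Balaban1983to89.B15Ineq184BlockAxial` — T. Bałaban, *Large field renormalization. I. The basic step of the 𝐑
# operation*, Commun. Math. Phys. **122** (1989) 175–202 [Balaban1989LargeFieldI], p. 197: the FIRST INPUT of
# (1.84), *"We take it in the axial gauge in k-blocks, hence |M^j(U₀) − Q^{s*}_{k−j}V_Λ| < 11d²O(1)B₃B₅M⁵ε_k inside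
# Λ, by the estimate (1.80), and (1.65) [14]"*, PROVED on the `ℤ^d` carriers of the tree from (1.80) and the
# general-background descent (1.65) of [14] (`B8Ineq165Descent`), with the background tower of pull-backs
# `Q^{s*}_{k−j}V_Λ` ((1.3) [III]) — and with it **(1.84)** *"This and (1.83) imply |M^j(U₀) − 1| <
# O(1)B₃B₅M⁶ε_k inside Λ"* from (1.80), (1.78)/(1.83) and the two axial gauges, by name

statement-level skeleton of published theorems with citation tags; proofs where landed; nothing here is a claim about the Yang–Mills mass gap

PDF held: `paper:balaban1989-cmp122-large-field-i` (journal page = PDF page + 174; p. 197 = PDF p. 23, pp. 194–195 = PDF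
pp. 20–21; text layer re-read for this file); [14] = [Balaban1985RegularSpaces] p. 87 (1.65) (PDF p. 13 of
`paper:balaban1985-cmp99-regular-spaces-gauge-fixing`); [III] = [Balaban1988Convergent] p. 246 (1.3).

WHAT IS REPRODUCED (mega-formalization `lit-balaban`, HOME `run/shared/lean/pub/lit-balaban/`, Phase-2 seat p26,
generation 6; SKELETON row **B15.Eq1.84** (r12), typed leaf `B15.BasicStep.Ineq184 dev C B₃ B₅ M ε_k := dev <
C·B₃·B₅·M⁶·ε_k`; the seat's generation-5 file `B15Ineq183AxialGauge` proved (1.83) and the INFERENCE (1.84) ⇐ {first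
input, (1.83)} (`ineq184_of_inputs`) with the first input a hypothesis — here that input is DERIVED; referee ref-5).
P. 197 ll. 6–9, verbatim: *"Consider the configuration U₀ inside the domain Λ. We take it in the axial gauge in
k-blocks, hence |M^j(U₀) − Q^{s*}_{k−j}V_Λ| < 11d²O(1)B₃B₅M⁵ε_k inside Λ, by the estimate (1.80), and (1.65) [14]. This
and (1.83) imply  |M^j(U₀) − 1| < O(1)B₃B₅M⁶ε_k inside Λ. (1.84)"*.  Inputs, verbatim: (1.80) p. 195 *"|U₀(∂p) − 1| <
2ε_kη² + O(1)B₃B₅M⁵ exp(−δ dist(p, Λ))ε_kη² for p ∈ Ω_k"*; (1.78) p. 194 *"|V_Λ(∂p′) − 1| < B₅M⁵ε for p′ ∈ Λ"*;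
(1.79) *"U₀ = U_{k,Z}(V_Λ)"*, p. 197 *"The configuration M_k(U₀) = V_Λ … We fix for it the axial gauge in Λ^{(k)}"*;
[III] (1.3) p. 246 *"(Q₁^{s*}V)(b) = 1 for b ⊂ B(y), y ∈ T^{(1)}; = V(c) for b ∈ B(c) = {b : b₋ ∈ B(c₋), b₊ ∈
B(c₊)}, c ∈ T^{(1)}"*; [14] (1.65) p. 87 *"|(\overline{U′U₀})ʲ − Ū₀ʲ| = |Ũ′ʲ − 1| < 8d²α₀/(1 − L⁻²) + α₁ <
11d²α₀ + α₁"*; [14] (1.15) p. 78 (the axial gauge in blocks) *"Ū^{j−1}(Γ_{x_j,x_{j−1}}) = 1 for x_{j−1} ∈ B(x_j),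
…, U(Γ_{x₁,x}) = 1 for x ∈ B(x₁)"*.

THE PROOF (the printed sentence, unfolded).  §1–§2: the pull-back `Q^{s*}` of [III] (1.3) on the `ℤ^d` carrier
(`pull`, tower `pullIter`; the torus version is `BalabanImbrieJaffe1984to88.BIJ85Eq453GaugeField.qsstarG`) and its
three properties, all from ONE local picture — on every two-block region `B(c₋) ∪ B(c₊)` the pulled-back field IS A
PURE GAUGE `1^u`, `u = 1` on `B(c₋)`, `u = V(c)⁻¹` on `B(c₊)` (`agree_pair`): (a) its plaquette variables there are
`= 1` (`plaqSmall_pull_pair`), (b) its block tree holonomies are `= 1` (`axialFn_pull_eq_one`: the axial gauge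
RELATIVE to `Q^{s*}V` in a block is the plain axial gauge (1.15)), (c) THE SECTION PROPERTY `\overline{Q^{s*}V} = V`
for the average (42) of [Balaban1985Averaging] (`bavg_pull`; torus/decimation version:
`BIJ85Eq453GaugeField.axialAvg_qsstarG`).  §3: hence the background tower `Bg n = Q^{s*}_nV_Λ`, `V_Λ = M^k(U₀)`,
satisfies every hypothesis of the general-background descent `B8Ineq165Descent.descent_bg` — top closeness `α₁ = 0`
(`M^k(U₀) = V_Λ`), background plaquettes trivially small on block pairs (this is why no `k`-dependence enters),
(1.19) relative gauge = (1.15) *"the axial gauge in k-blocks"* — and (1.65) reads `|M^{k−n}(U₀)(b) − (Q^{s*}_nV_Λ)(b)| ≤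
Σ_{m<n} 4d²L²a_{m+1}` with the per-level plaquette bounds `a_n` of `M^{k−n}(U₀)` on `Λ` (`norm_avg_sub_pull_le`,
LOCAL: only plaquettes over `Λ` enter); with (1.80) inside `Λ` in the form *"|U₀(∂p) − 1| < αη²"*, `α =
O(1)B₃B₅M⁵ε_k`, Proposition 2 of [Balaban1985Averaging] gives `a_n = 2αL^{−2n}` (`B8Ineq130.ineq128_global`) and
the printed `8d²α(L^{−2(n−1)} + … + 1) < 11d²α` (`norm_avg_sub_pull_lt`).  §4: `|(Q^{s*}_nV_Λ)(b) − 1|` is `0` or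
`|V_Λ(c) − 1|` for a bond `c ⊂ Λ^{(k)}` (`norm_pullIter_sub_one_le`), which in the axial gauge of `Λ^{(k)}` is (1.83)
(`B15Ineq183AxialGauge.Hyp183.norm_axial_bond_sub_one_le`); the triangle inequality is the generation-5
`ineq184_of_inputs`, giving the leaf `B15.BasicStep.Ineq184` BY NAME (`ineq184`).

DICTIONARY.  Unit lattice = `T^{(k)}_1 ⊃ Λ^{(k)} = [lo, hi]` (≤ `D + 1 ≤ 100M + 1` sites per direction, p. 192
(1.73)); `η = L^{−k}`; level `j` ↦ depth `n = k − j`, the `L^{−n}`-lattice ↦ `ℤ^d` with `Λ^{(j)} = [tlo L lo n,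
thi L hi n]` (`B8Ineq130`); `U₀` ↦ `U` (depth `k`), `M^j(U₀)` ↦ `avgIter L U j` ((43) of [Balaban1985Averaging]),
`V_Λ = M^k(U₀)` ↦ `avgIter L U k` (so (1.79)'s "M_k(U₀) = V_Λ" is definitional here — HONEST SCOPE (2)),
`Q^{s*}_{k−j}V_Λ` ↦ `pullIter L (avgIter L U k) n`; "axial gauge in k-blocks" ↦ (1.15) of [14] between all
consecutive levels on the cubes (`h15`, as in `B8Ineq130.descent`); "axial gauge in Λ^{(k)}" ↦ `V_Λ(Γ_{lo,x}) = 1`,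
`x ∈ Λ^{(k)}` (`hgax`, root = the corner `lo`, as in `B15Ineq183AxialGauge`); (1.80) inside `Λ` ↦ `pdev U < α·L^{−2k}`
(global sup form of `B7Prop2Explicit`, `α = K·B₃B₅M⁵ε_k`); (1.78) ↦ `PlaqSmall (avgIter L U k) lo hi a₀`, `a₀ ≤
K₅·B₅M⁵ε_k`.

HONEST SCOPE / DEVIATIONS.  (1) `ℤ^d` carriers and an `AvgClosed` value group `G ≤ U1 𝔸` (`U(N)`, `SU(N)`), as in
all B7/B8 `ℤ^d` files; (1.80) in the GLOBAL sup form for the printed-constant corollaries (the abstract theorem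
`norm_avg_sub_pull_le` is local: plaquettes over `Λ` only); the exponential tail of (1.80) outside `Λ` is not used
("inside Λ").  (2) `V_Λ := M^k(U₀)`: nothing of Proposition 1 / (1.79) (existence of `U₀ = U_{k,Z}(V_Λ)`, minimality)
is used or asserted; (1.78) for `M^k(U₀)` on `Λ^{(k)}` and (1.80) are hypotheses of the printed shape.  (3) The two
gauge conditions are hypotheses on `U` in `ineq184` (jointly satisfiable, e.g. `U = 1`); §5 `ineq184_orbit` removes
them: by the tree's EXISTENCE of the gauge `B8Eq115GaugeFixing.gaugeFix_global` ([14] p. 78 "these equations …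
determine uniquely an element in each orbit"), EVERY `G`-valued `U₀` with (1.80) and (1.78) has the representative
`U₀^{u}`, `u = towerGauge L U₀ k lo`, in the axial gauge in `k`-blocks with `V_Λ` axial in `Λ^{(k)}`, and (1.84)
holds for it (the bound is a statement about this representative, as in print — `|M^j(U₀) − 1|` is not gauge
invariant).  (4) Constants: `11d²` exactly as printed for the first input; `O(1)` of (1.84) ↦ `11d²K +
100dK₅` via `ineq184_of_inputs`; `≤`/`<` as the inputs allow.  Every declaration is a definition with a body (`pull`,
`pullIter`, [III] (1.3)) or a proved theorem; no new `Prop` fact.  Unit `lit-balaban-p26`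
(literature-prover-lit-balaban-p26-g6-0).
-/

noncomputable section

open scoped BigOperators
open NormedSpace Finset

namespace Literature.MathematicalPhysics.QuantumFieldTheory.Balaban1983to89.B15Ineq184BlockAxial

open B7Prop1Explicit B7Prop2Explicit B7Prop1Local MatrixLog B8Lemma1NonAbelian B8Ineq129 B8Ineq130
  B8Ineq165Descent B7AvgGaugeCovariance B8Eq115GaugeFixing
open B8Lemma1Lattice (InBlock)

-- `Site` alone would resolve to the torus sites of `Setup.lean`; re-export the `ℤ^d` sites of `B7Prop1Explicit`.
export B7Prop1Explicit (Site)

variable {d : ℕ}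

/-! ## §0 Block arithmetic: the coarse site `fl L x = ⌊x/L⌋` below a fine site -/

section Blocks

/-- `⌊t/L⌋ = c` on the block `[Lc, Lc + L − 1]`. [folklore] -/
private theorem ediv_eq_of_mem {L : ℕ} (hL : 1 ≤ L) {t c : ℤ} (h1 : (L : ℤ) * c ≤ t)
    (h2 : t ≤ (L : ℤ) * c + ((L : ℤ) - 1)) : t / (L : ℤ) = c := by
  have hLpos : (0 : ℤ) < L := by exact_mod_cast hL
  have h3 : c ≤ t / (L : ℤ) := (Int.le_ediv_iff_mul_le hLpos).mpr (by rw [mul_comm]; exact h1)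
  have h4 : t / (L : ℤ) < c + 1 := (Int.ediv_lt_iff_lt_mul hLpos).mpr (by nlinarith)
  omega

/-- Coordinatewise: `fl L x i = c` when `Lc ≤ x_i ≤ Lc + L − 1`. [folklore] -/
private theorem fl_apply_eq {L : ℕ} (hL : 1 ≤ L) {x : Site d} {i : Fin d} {c : ℤ} (h1 : (L : ℤ) * c ≤ x i)
    (h2 : x i ≤ (L : ℤ) * c + ((L : ℤ) - 1)) : fl L x i = c :=
  ediv_eq_of_mem hL h1 h2

-- The block lemmas `fl_eq_of_inBlock`, `fl_smul`, `fl_block` (`fl L (Lz + r) = z`) are the tree's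
-- (`B8Eq115GaugeFixing`), used BY NAME.

/-- `z + e_κ ≠ z`. [folklore] -/
private theorem add_e_ne_self (z : Site d) (κ : Fin d) : z + e κ ≠ z := fun h => by
  have := congrFun h κ
  rw [Pi.add_apply, e_apply_self] at this
  omega

/-- `Le_κ ≤ pairTop L κ` (the corner of `B(c₊)` lies in `B(c₋) ∪ B(c₊)`), `L ≥ 1`. [folklore] -/
private theorem smul_e_le_pairTop {L : ℕ} (hL : 1 ≤ L) (κ : Fin d) : (L : ℤ) • e κ ≤ pairTop L κ := by
  intro i
  simp only [zsmul_e_apply, pairTop]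
  split_ifs <;> omega

/-- Points `q + s`, `0 ≤ s ≤ pairTop L κ`, lie in the two-block box `[q, q + pairTop L κ]`. [folklore] -/
private theorem inBox_pair {L : ℕ} (q : Site d) (κ : Fin d) {s : Site d} (h0 : 0 ≤ s) (h1 : s ≤ pairTop L κ) :
    InBox q (q + pairTop L κ) (q + s) := fun i => by
  have h0i : (0 : Site d) i ≤ s i := h0 i
  have h1i : s i ≤ pairTop L κ i := h1 i
  simp only [Pi.zero_apply] at h0i
  simp only [Pi.add_apply]
  exact ⟨by omega, by omega⟩

/-- `q` itself lies in `[q, q + pairTop L κ]` (`L ≥ 1`). [folklore] -/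
private theorem inBox_pair_self {L : ℕ} (hL : 1 ≤ L) (q : Site d) (κ : Fin d) : InBox q (q + pairTop L κ) q :=
  fun i => ⟨le_rfl, by simp only [Pi.add_apply, pairTop]; split_ifs <;> omega⟩

end Blocks

/-! ## §1 The pull-back `Q^{s*}` of [III] (1.3) on the `ℤ^d` carrier, and its tower `Q^{s*}_n` -/

section Pull

variable {G : Type*} [Group G]

/-- **[III] (1.3)** p. 246 (= [BalabanImbrieJaffe1985] (4.5.3)), on the `ℤ^d` carrier, one step: the pull-back
`Q^{s*}V` of a configuration `V` of the coarse lattice to the `L`-times finer one — *"(Q₁^{s*}V)(b) = 1 for b ⊂ B(y),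
y ∈ T^{(1)}; = V(c) for b ∈ B(c) = {b : b₋ ∈ B(c₋), b₊ ∈ B(c₊)}, c ∈ T^{(1)}"*: the bond `⟨x, x + e_μ⟩` carries `1` if
both ends lie in one block (`fl L (x + e_μ) = fl L x`), and `V⟨fl L x, μ⟩` if it crosses from `B(fl L x)` to
`B(fl L x + e_μ)` (torus version: `BIJ85Eq453GaugeField.qsstarG`). [cite: Balaban1988Convergent, (1.3) p.246] -/
def pull (L : ℕ) (V : Site d → Fin d → G) : Site d → Fin d → G :=
  fun x μ => if fl L (x + e μ) = fl L x then 1 else V (fl L x) μ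

/-- The `n`-fold pull-back `Q^{s*}_n` (`Q^{s*}_{n+1} = Q^{s*}Q^{s*}_n`; in [Balaban1989LargeFieldI] p. 197 the
background `Q^{s*}_{k−j}V_Λ` of the `j`-th lattice, depth `n = k − j`). [cite: Balaban1988Convergent, (1.3) p.246] -/
def pullIter (L : ℕ) (V : Site d → Fin d → G) : ℕ → Site d → Fin d → G
  | 0 => V
  | n + 1 => pull L (pullIter L V n)

/-- `Q^{s*}_0 = id`. [cite: Balaban1988Convergent, (1.3) p.246] -/
@[simp] theorem pullIter_zero (L : ℕ) (V : Site d → Fin d → G) : pullIter L V 0 = V := rfl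

/-- `Q^{s*}_{n+1} = Q^{s*}(Q^{s*}_n)`. [cite: Balaban1988Convergent, (1.3) p.246] -/
theorem pullIter_succ (L : ℕ) (V : Site d → Fin d → G) (n : ℕ) :
    pullIter L V (n + 1) = pull L (pullIter L V n) := rfl

/-- (1.3), first case: a bond inside one block carries `1`. [cite: Balaban1988Convergent, (1.3) p.246] -/
theorem pull_of_interior (L : ℕ) (V : Site d → Fin d → G) {x : Site d} {μ : Fin d}
    (h : fl L (x + e μ) = fl L x) : pull L V x μ = 1 := by
  show (if fl L (x + e μ) = fl L x then (1 : G) else V (fl L x) μ) = 1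
  rw [if_pos h]

/-- (1.3), second case: a bond of the corridor `B(c)`, `c = ⟨fl L x, μ⟩`, carries `V(c)`.
[cite: Balaban1988Convergent, (1.3) p.246] -/
theorem pull_of_cross {L : ℕ} (V : Site d → Fin d → G) {x : Site d} {μ : Fin d}
    (h : fl L (x + e μ) = fl L x + e μ) : pull L V x μ = V (fl L x) μ := by
  show (if fl L (x + e μ) = fl L x then (1 : G) else V (fl L x) μ) = _
  rw [if_neg]
  rw [h]; exact add_e_ne_self _ _

/-- `Q^{s*}V` takes values in any subgroup containing those of `V`. [cite: Balaban1988Convergent, (1.3) p.246] -/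
theorem pull_mem (L : ℕ) {S : Subgroup G} {V : Site d → Fin d → G} (hV : ∀ x κ, V x κ ∈ S) (x : Site d)
    (κ : Fin d) : pull L V x κ ∈ S := by
  unfold pull; split_ifs; exacts [S.one_mem, hV _ _]

/-- `Q^{s*}_nV` takes values in any subgroup containing those of `V`. [cite: Balaban1988Convergent, (1.3) p.246] -/
theorem pullIter_mem (L : ℕ) {S : Subgroup G} {V : Site d → Fin d → G} (hV : ∀ x κ, V x κ ∈ S) :
    ∀ (n : ℕ) (x : Site d) (κ : Fin d), pullIter L V n x κ ∈ S
  | 0, x, κ => hV x κ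
  | n + 1, x, κ => pull_mem L (pullIter_mem L hV n) x κ

/-- **THE LOCAL PICTURE**: on the two-block region `B(c₋) ∪ B(c₊) = [Lz, Lz + pairTop L κ]` of the coarse bond
`c = ⟨z, z + e_κ⟩`, the pulled-back field `Q^{s*}V` coincides with the PURE GAUGE `1^u`, `u = 1` on `B(c₋)` and
`u = V(c)⁻¹` off it (so on `B(c₊)`): interior bonds carry `u(x)u(x′)⁻¹ = 1`, the corridor bonds `1·(V(c)⁻¹)⁻¹ = V(c)`.
[cite: Balaban1988Convergent, (1.3) p.246] -/
private theorem agree_pair {L : ℕ} (hL : 1 ≤ L) (V : Site d → Fin d → G) (z : Site d) (κ : Fin d) :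
    AgreeOn ((L : ℤ) • z) ((L : ℤ) • z + pairTop L κ) (pull L V)
      (gaugeAct (fun x => if fl L x = z then (1 : G) else (V z κ)⁻¹) 1) := by
  intro x μ hx hxμ
  simp only [pull, gaugeAct, Pi.one_apply, mul_one]
  by_cases h : fl L (x + e μ) = fl L x
  · rw [if_pos h, h, mul_inv_cancel]
  · rw [if_neg h]
    have hcr : fl L (x + e μ) = fl L x + e μ := (fl_add_e hL x μ).resolve_left h
    -- the coordinates `i ≠ κ` of both endpoints lie in the block range of `z`
    have hflx : ∀ i, i ≠ κ → fl L x i = z i := fun i hi => by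
      have h1 := (hx i).1
      have h2 := (hx i).2
      simp only [Pi.add_apply, Pi.smul_apply, smul_eq_mul, pairTop, if_neg hi] at h1 h2
      exact fl_apply_eq hL h1 h2
    have hflx' : ∀ i, i ≠ κ → fl L (x + e μ) i = z i := fun i hi => by
      have h1 := (hxμ i).1
      have h2 := (hxμ i).2
      simp only [Pi.add_apply, Pi.smul_apply, smul_eq_mul, pairTop, if_neg hi] at h1 h2
      exact fl_apply_eq hL (by simp only [Pi.add_apply] ; exact h1) (by simp only [Pi.add_apply]; exact h2)
    -- hence the crossing direction is `κ`
    have hμκ : μ = κ := by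
      by_contra hne
      have h1 := congrFun hcr μ
      rw [hflx' μ hne, Pi.add_apply, hflx μ hne, e_apply_self] at h1
      omega
    rw [hμκ] at hcr ⊢
    -- and the crossing happens at the face of `B(Lz)`: `fl L x = z`
    have hx1 := (hx κ).1
    have hx2 := (hxμ κ).2
    rw [hμκ] at hx2
    simp only [Pi.add_apply, Pi.smul_apply, smul_eq_mul, pairTop, ↓reduceIte, e_apply_self] at hx1 hx2
    have hcrκ : fl L (x + e κ) κ = fl L x κ + 1 := by
      have := congrFun hcr κ; rwa [Pi.add_apply, e_apply_self] at this
    have hflκ : fl L x κ = z κ := by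
      by_contra hne
      have hge : (L : ℤ) * z κ + L ≤ x κ := by
        by_contra hlt
        exact hne (fl_apply_eq hL hx1 (by omega))
      have e1 : fl L x κ = z κ + 1 := fl_apply_eq hL (by linarith) (by linarith)
      have e2 : fl L (x + e κ) κ = z κ + 1 :=
        fl_apply_eq hL (by simp only [Pi.add_apply, e_apply_self]; linarith)
          (by simp only [Pi.add_apply, e_apply_self]; linarith)
      omega
    have hfl : fl L x = z := by
      funext i
      by_cases hi : i = κ
      · rw [hi]; exact hflκ
      · exact hflx i hi
    have hfl' : fl L (x + e κ) = z + e κ := by rw [hcr, hfl]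
    rw [hfl, hfl', if_pos rfl, if_neg (add_e_ne_self z κ), one_mul, inv_inv]

/-- **(1.3) ⟹ the plaquette variables of `Q^{s*}V` on every two-block region `B(c₋) ∪ B(c₊)` are `= 1`** (a plaquette
inside one block carries only `1`'s; one crossing the face `B(c₋)|B(c₊)` carries `V(c)·V(c)⁻¹` around two `1`'s —
cf. the torus statement `BIJ85Eq453GaugeField.plaqHol_qsstarG_of_not_mem`; here: a pure gauge has trivial holonomy
around closed contours). [cite: Balaban1988Convergent, (1.3) p.246] -/
theorem hol_plaqWord_pull {L : ℕ} (hL : 1 ≤ L) (V : Site d → Fin d → G) (z : Site d) (κ : Fin d) {x : Site d}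
    {μ ν : Fin d} (hx : (L : ℤ) • z ≤ x) (hx' : x + e μ + e ν ≤ (L : ℤ) • z + pairTop L κ) :
    hol (pull L V) x (plaqWord μ ν) = 1 := by
  have hxhi : x ≤ (L : ℤ) • z + pairTop L κ :=
    (le_add_of_nonneg_right (add_nonneg (e_nonneg μ) (e_nonneg ν))).trans (by rw [← add_assoc]; exact hx')
  have hxlo : (L : ℤ) • z ≤ x + e μ + e ν :=
    hx.trans (by rw [add_assoc]; exact le_add_of_nonneg_right (add_nonneg (e_nonneg μ) (e_nonneg ν)))
  rw [hol_plaqWord_congr (agree_pair hL V z κ) x μ ν (inBox_of_le hx hxhi) (inBox_of_le hxlo hx'),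
    hol_gaugeAct_closed _ _ _ _ (disp_plaqWord μ ν), hol_one, mul_one, mul_inv_cancel]

variable {𝔸 : Type*} [NormedRing 𝔸]

/-- **The background plaquette hypothesis of the descent holds trivially for `Q^{s*}V`**: `PlaqSmall (Q^{s*}V) (Lz)
(Lz + pairTop L κ) a` for EVERY `a ≥ 0` and every coarse bond `⟨z, z + e_κ⟩` (all these plaquette variables are `1`).
This is why the first input of (1.84) carries no `k`-dependence. [cite: Balaban1989LargeFieldI, p.197 ll.6–8] -/
theorem plaqSmall_pull_pair {L : ℕ} (hL : 1 ≤ L) (V : Site d → Fin d → 𝔸ˣ) (z : Site d) (κ : Fin d) {a : ℝ}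
    (ha : 0 ≤ a) : B8Lemma1NonAbelian.PlaqSmall (pull L V) ((L : ℤ) • z) ((L : ℤ) • z + pairTop L κ) a :=
  fun x μ ν _ hx hx' => by
    rw [hol_plaqWord_pull hL V z κ hx hx', Units.val_one, sub_self, norm_zero]; exact ha

end Pull

/-! ## §2 The block tree holonomies and THE SECTION PROPERTY `\overline{Q^{s*}V} = V` for the average (42) -/

section Section42

variable {G : Type*} [Group G]

/-- **"The axial gauge in k-blocks"** for the background: the tree contour `Γ_{Lz,x}`, `x ∈ B(Lz)`, of `Q^{s*}V`
carries `1` (all its bonds lie inside the block) — so the axial gauge (1.19) of [14] RELATIVE to `Q^{s*}V` inside a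
block is the plain block axial gauge (1.15). [cite: Balaban1985RegularSpaces, (1.15) p.78] -/
theorem axialFn_pull_eq_one {L : ℕ} (hL : 1 ≤ L) (hd : 1 ≤ d) (V : Site d → Fin d → G) (z : Site d)
    (r : Fin d → Fin L) : axialFn (pull L V) ((L : ℤ) • z) ((L : ℤ) • z + boxVec L r) = 1 := by
  have κ : Fin d := ⟨0, hd⟩
  rw [axialFn_congr (agree_pair hL V z κ) _ _ (inBox_pair_self hL _ κ)
    (inBox_pair _ κ (boxVec_nonneg L r) (boxVec_le_pairTop L κ r))]
  unfold axialFn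
  rw [hol_gaugeAct, hol_one, mul_one, add_sub_cancel_left, disp_treeWord]
  rw [fl_smul hL, if_pos rfl, fl_block hL, if_pos rfl, inv_one, mul_one]

/-- The straight contour `Γ_c` of the coarse bond `c = ⟨z, z + e_κ⟩`, started at a point `Lz + r` of `B(c₋)`: its
`Q^{s*}V`-holonomy is `V(c)` (one corridor bond, the rest interior). [cite: Balaban1988Convergent, (1.3) p.246] -/
theorem hol_pull_seg {L : ℕ} (hL : 1 ≤ L) (V : Site d → Fin d → G) (z : Site d) (κ : Fin d)
    (r : Fin d → Fin L) :
    hol (pull L V) ((L : ℤ) • z + boxVec L r) (seg κ L) = V z κ := by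
  have hq := inBox_pair ((L : ℤ) • z) κ (boxVec_nonneg L r) (boxVec_le_pairTop L κ r)
  have hqL : InBox ((L : ℤ) • z) ((L : ℤ) • z + pairTop L κ) ((L : ℤ) • z + boxVec L r + (L : ℤ) • e κ) := by
    rw [add_assoc]
    exact inBox_pair _ κ (add_nonneg (boxVec_nonneg L r) (zsmul_e_nonneg (by positivity) κ))
      (boxVec_add_seg_le_pairTop L κ r)
  have hs : (L : ℤ) • z + boxVec L r + (L : ℤ) • e κ = (L : ℤ) • (z + e κ) + boxVec L r := by
    rw [smul_add]; abel
  rw [hol_seg_congr (agree_pair hL V z κ) κ L _ hq hqL]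
  simp only [hol_gaugeAct, hol_one, mul_one, disp_seg]
  rw [hs, fl_block hL, fl_block hL, if_pos rfl, if_neg (add_e_ne_self z κ), one_mul,
    inv_inv]

variable {𝔸 : Type*} [NormedRing 𝔸] [NormOneClass 𝔸] [NormedAlgebra ℂ 𝔸] [CompleteSpace 𝔸]

omit [NormOneClass 𝔸] [NormedAlgebra ℂ 𝔸] [CompleteSpace 𝔸] in
/-- The loop variables `(Q^{s*}V)(Γ_{c,x})(Q^{s*}V)(c)⁻¹` of the average (42) all equal `1` (a pure gauge around a
closed contour). [cite: Balaban1985Averaging, (42) p.23] -/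
theorem Wcx_pull {L : ℕ} (hL : 1 ≤ L) (V : Site d → Fin d → 𝔸ˣ) (z : Site d) (κ : Fin d) (r : Fin d → Fin L) :
    Wcx L (pull L V) ((L : ℤ) • z) κ (boxVec L r) = 1 := by
  set q : Site d := (L : ℤ) • z with hqdef
  have hq := inBox_pair_self hL q κ
  have hqr := inBox_pair q κ (boxVec_nonneg L r) (boxVec_le_pairTop L κ r)
  have hqrL : InBox q (q + pairTop L κ) (q + boxVec L r + (L : ℤ) • e κ) := by
    rw [add_assoc]
    exact inBox_pair _ κ (add_nonneg (boxVec_nonneg L r) (zsmul_e_nonneg (by positivity) κ))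
      (boxVec_add_seg_le_pairTop L κ r)
  have hqL := inBox_pair q κ (zsmul_e_nonneg (by positivity : (0 : ℤ) ≤ L) κ) (smul_e_le_pairTop hL κ)
  have hdisp : disp (gammaWord L κ (boxVec L r) ++ seg κ (-(L : ℤ))) = 0 := by
    rw [disp_append, disp_gammaWord, disp_seg, neg_smul, add_neg_cancel]
  rw [Wcx_congr L (agree_pair hL V z κ) q κ (boxVec L r) hq hqr hqrL hqL, Wcx_eq_hol_loop,
    hol_gaugeAct_closed _ _ _ _ hdisp, hol_one, mul_one, mul_inv_cancel]

omit [NormOneClass 𝔸] in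
/-- **THE SECTION PROPERTY `\overline{Q^{s*}V} = V`** for the average (42) of [Balaban1985Averaging] on the `ℤ^d`
carrier: `\overline{(Q^{s*}V)}_c = exp[Σ_x L^{−d} log 1]·(Q^{s*}V)(Γ_c) = V(c)` — the pulled-back configuration has
the prescribed block averages (torus/decimation version: `BIJ85Eq453GaugeField.axialAvg_qsstarG`; in
[Balaban1989LargeFieldI] p. 197 this is what makes `Q^{s*}_{k−j}V_Λ` the `j`-th average of the background,
`M(Q^{s*}_{n+1}V_Λ) = Q^{s*}_nV_Λ`). [cite: Balaban1989LargeFieldI, p.197 ll.6–8] -/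
theorem bavg_pull {L : ℕ} (hL : 1 ≤ L) (V : Site d → Fin d → 𝔸ˣ) (z : Site d) (κ : Fin d) :
    bavg L (pull L V) ((L : ℤ) • z) κ = V z κ := by
  have hX : Xavg L (pull L V) ((L : ℤ) • z) κ = 0 := by
    simp only [Xavg, Wcx_pull hL, Units.val_one, mlog_one, smul_zero, Finset.sum_const_zero]
  have hseg : hol (pull L V) ((L : ℤ) • z) (seg κ L) = V z κ := by
    have h := hol_pull_seg hL V z κ (fun _ => ⟨0, hL⟩)
    have h0 : boxVec L (fun _ : Fin d => (⟨0, hL⟩ : Fin L)) = 0 := by funext i; simp [boxVec]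
    rwa [h0, add_zero] at h
  apply Units.ext
  rw [show bavg L (pull L V) ((L : ℤ) • z) κ =
      expUnit (Xavg L (pull L V) ((L : ℤ) • z) κ) * hol (pull L V) ((L : ℤ) • z) (seg κ L) from rfl,
    Units.val_mul, val_expUnit, hX, exp_zero, one_mul, hseg]

omit [NormOneClass 𝔸] in
/-- The section property along the tower: `\overline{Q^{s*}_{n+1}V} = Q^{s*}_nV` (rescaled to the coarse lattice:
`rescale L (bavg L (Q^{s*}_{n+1}V)) = Q^{s*}_nV`). [cite: Balaban1989LargeFieldI, p.197 ll.6–8] -/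
theorem rescale_bavg_pullIter {L : ℕ} (hL : 1 ≤ L) (V : Site d → Fin d → 𝔸ˣ) (n : ℕ) :
    rescale L (bavg L (pullIter L V (n + 1))) = pullIter L V n := by
  funext z κ
  rw [rescale_apply, pullIter_succ, bavg_pull hL]

end Section42

/-! ## §3 *"hence |M^j(U₀) − Q^{s*}_{k−j}V_Λ| < 11d²O(1)B₃B₅M⁵ε_k inside Λ, by the estimate (1.80), and (1.65) [14]"* -/

section FirstInput

variable {𝔸 : Type*} [NormedRing 𝔸] [NormOneClass 𝔸] [NormedAlgebra ℂ 𝔸] [CompleteSpace 𝔸]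

omit [NormOneClass 𝔸] [NormedAlgebra ℂ 𝔸] [CompleteSpace 𝔸] in
/-- `|(Q^{s*}_nV)(b) − 1|` is `0` or `|V(c) − 1|` for a bond `c` of the top cube: if `|V(c) − 1| ≤ B` on the bonds of
`[lo, hi]`, then `|(Q^{s*}_nV)(b) − 1| ≤ B` on the bonds of the depth-`n` cube `[tlo n, thi n]`.
[cite: Balaban1988Convergent, (1.3) p.246] -/
theorem norm_pullIter_sub_one_le {L : ℕ} (hL : 1 ≤ L) (lo hi : Site d) (V : Site d → Fin d → 𝔸ˣ) {B : ℝ}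
    (hB : 0 ≤ B) (htop : ∀ x ν, lo ≤ x → x + e ν ≤ hi → ‖((V x ν : 𝔸ˣ) : 𝔸) - 1‖ ≤ B) :
    ∀ (n : ℕ) (x : Site d) (ν : Fin d), tlo L lo n ≤ x → x + e ν ≤ thi L hi n →
      ‖((pullIter L V n x ν : 𝔸ˣ) : 𝔸) - 1‖ ≤ B
  | 0, x, ν, hx, hxν => by simpa using htop x ν hx hxν
  | n + 1, x, ν, hx, hxν => by
    rw [pullIter_succ]
    rcases fl_add_e hL x ν with hsame | hcross
    · rw [pull_of_interior L _ hsame, Units.val_one, sub_self, norm_zero]; exact hB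
    · rw [pull_of_cross _ hcross]
      have hxhi : x ≤ thi L hi (n + 1) := le_of_add_e_le hxν
      have hxν' : tlo L lo (n + 1) ≤ x + e ν := hx.trans (le_add_of_nonneg_right (e_nonneg ν))
      obtain ⟨hz, _⟩ := fl_mem hL hx hxhi
      obtain ⟨_, hw'⟩ := fl_mem hL hxν' hxν
      rw [hcross] at hw'
      exact norm_pullIter_sub_one_le hL lo hi V hB htop n (fl L x) ν hz hw'

/-- **THE FIRST INPUT OF (1.84), abstract local form** — *"|M^j(U₀) − Q^{s*}_{k−j}V_Λ| … inside Λ … by (1.65)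
[14]"*: on the tower of cubes `Λ^{(j)} = [tlo n, thi n]` below `Λ^{(k)} = [lo, hi]`, `n = k − j`, let the averages
`M^j(U₀) = avgIter L U j` be `{|u| ≤ 1, |u⁻¹| ≤ 1}`-valued, let `M^{k−n}(U₀)`, `n ≥ 1`, have plaquette variables
within `a_n` of `1` on `Λ^{(k−n)}` ((1.80) + Prop. 2 of [Balaban1985Averaging]), and let `U₀` be *"in the axial
gauge in k-blocks"* ((1.15) of [14] between all consecutive levels on the cubes); then with `V_Λ = M^k(U₀)` and the
background tower `Q^{s*}_nV_Λ`, the general-background descent (1.65) of [14] (`B8Ineq165Descent.descent_bg`: top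
closeness `α₁ = 0`, background plaquettes `= 1` on block pairs, relative gauge = (1.15) by `axialFn_pull_eq_one`,
tower consistency = the section property `bavg_pull`) gives, for every bond `b = ⟨x, x + e_ν⟩ ⊂ Λ^{(k−n)}`:
`|M^{k−n}(U₀)(b) − (Q^{s*}_nV_Λ)(b)| ≤ Σ_{m<n} 4d²L²a_{m+1}` (provided `a_nL² ≤ 1/(6(d+1))`, `Σ_{m<k} 4d²L²a_{m+1} ≤
1/6`). [cite: Balaban1989LargeFieldI, p.197 ll.6–8] -/
theorem norm_avg_sub_pull_le {L : ℕ} (hL : 1 ≤ L) (hd : 1 ≤ d) (lo hi : Site d) (U : Site d → Fin d → 𝔸ˣ)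
    (k : ℕ) (a : ℕ → ℝ)
    (hmem : ∀ j ≤ k, ∀ x μ, avgIter L U j x μ ∈ U1 𝔸)
    (hplaq : ∀ n, 1 ≤ n → n ≤ k →
      B8Lemma1NonAbelian.PlaqSmall (avgIter L U (k - n)) (tlo L lo n) (thi L hi n) (a n))
    (h15 : ∀ n, n < k → ∀ z, tlo L lo n ≤ z → z ≤ thi L hi n → ∀ r : Fin d → Fin L,
      axialFn (avgIter L U (k - (n + 1))) ((L : ℤ) • z) ((L : ℤ) • z + boxVec L r) = 1)
    (ha : ∀ n, 1 ≤ n → n ≤ k → 0 < a n ∧ a n * (L : ℝ) ^ 2 ≤ 1 / (6 * ((d : ℝ) + 1)))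
    (htot : ∑ m ∈ Finset.range k, 4 * (d : ℝ) ^ 2 * (L : ℝ) ^ 2 * a (m + 1) ≤ 1 / 6)
    (n : ℕ) (hn : n ≤ k) (x : Site d) (ν : Fin d) (hx : tlo L lo n ≤ x) (hxν : x + e ν ≤ thi L hi n) :
    ‖((avgIter L U (k - n) x ν : 𝔸ˣ) : 𝔸) - pullIter L (avgIter L U k) n x ν‖ ≤
      ∑ m ∈ Finset.range n, 4 * (d : ℝ) ^ 2 * (L : ℝ) ^ 2 * a (m + 1) := by
  have h := descent_bg hL hd lo hi U (pullIter L (avgIter L U k)) k a 0 hmem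
    (fun m _ x μ => pullIter_mem L (hmem k le_rfl) m x μ) hplaq
    (fun m hmk z _ _ κ => by
      rw [pullIter_succ]; exact plaqSmall_pull_pair hL _ z κ (ha (m + 1) (by omega) (by omega)).1.le)
    (fun m hmk z hz hz' r => by rw [h15 m hmk z hz hz' r, pullIter_succ, axialFn_pull_eq_one hL hd])
    (fun m _ z κ _ _ => by rw [pullIter_succ, bavg_pull hL])
    (fun x ν _ _ => by simp) le_rfl ha (by simpa using htot) n hn x ν hx hxν
  simpa using h

/-- **THE FIRST INPUT OF (1.84) WITH THE PRINTED CONSTANT** — *"hence |M^j(U₀) − Q^{s*}_{k−j}V_Λ| <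
11d²O(1)B₃B₅M⁵ε_k inside Λ, by the estimate (1.80), and (1.65) [14]"*, global `ℤ^d` model: if `U₀` is `G`-valued
(`G` closed under the average (42), e.g. `U(N)`), satisfies (1.80) inside `Λ` in the form `|U₀(∂p) − 1| < αη²`
(`α = O(1)B₃B₅M⁵ε_k`, `η = L^{−k}`; global sup form), `α` is Prop.-1/2-small and `11d²α ≤ 1/6`, and `U₀` is in the
axial gauge in `k`-blocks inside `Λ` ((1.15) of [14]), then for every `j = k − n` and every bond `b ⊂ Λ^{(j)}`:
`|M^j(U₀)(b) − (Q^{s*}_{k−j}V_Λ)(b)| ≤ 8d²α(L^{−2(n−1)} + … + 1) < 11d²α` — Proposition 2 of [Balaban1985Averaging]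
gives the levels' plaquette bounds `2α(Lʲη)²` (`B8Ineq130.ineq128_global`), then `norm_avg_sub_pull_le`, then the
geometric series of (1.65) (`B8Ineq165Descent.ineq165_members`). [cite: Balaban1989LargeFieldI, p.197 ll.6–8] -/
theorem norm_avg_sub_pull_lt (L : ℕ) (hL : 2 ≤ L) (hd : 1 ≤ d) {G : Subgroup 𝔸ˣ} (hG : AvgClosed d L G) (k : ℕ)
    (U : Site d → Fin d → 𝔸ˣ) (hU : ∀ x κ, U x κ ∈ G) {α : ℝ} (hα : 0 < α) (hα3 : C0 d * α ≤ 1 / 3)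
    (hα2 : 2 * α ≤ c2' d L) (hαs : 11 * (d : ℝ) ^ 2 * α ≤ 1 / 6)
    (h180 : pdev U < α * (((L : ℝ) ^ k)⁻¹) ^ 2) (lo hi : Site d)
    (h15 : ∀ n, n < k → ∀ z, tlo L lo n ≤ z → z ≤ thi L hi n → ∀ r : Fin d → Fin L,
      axialFn (avgIter L U (k - (n + 1))) ((L : ℤ) • z) ((L : ℤ) • z + boxVec L r) = 1)
    (n : ℕ) (hn : n ≤ k) (x : Site d) (ν : Fin d) (hx : tlo L lo n ≤ x) (hxν : x + e ν ≤ thi L hi n) :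
    ‖((avgIter L U (k - n) x ν : 𝔸ˣ) : 𝔸) - pullIter L (avgIter L U k) n x ν‖ ≤
        8 * (d : ℝ) ^ 2 * α * ∑ m ∈ Finset.range n, (((L : ℝ) ^ m)⁻¹) ^ 2 ∧
      8 * (d : ℝ) ^ 2 * α * ∑ m ∈ Finset.range n, (((L : ℝ) ^ m)⁻¹) ^ 2 < 11 * (d : ℝ) ^ 2 * α := by
  have hL1 : 1 ≤ L := le_trans (by norm_num) hL
  have hL' : (0 : ℝ) < L := by exact_mod_cast lt_of_lt_of_le (by norm_num) hL
  have hdiv : α / (L : ℝ) ^ 2 * (L : ℝ) ^ 2 = α := div_mul_cancel₀ _ (pow_ne_zero 2 hL'.ne')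
  have hβ : 0 < α / (L : ℝ) ^ 2 := by positivity
  have hα3' : C0 d * (α / (L : ℝ) ^ 2 * (L : ℝ) ^ 2) ≤ 1 / 3 := by rw [hdiv]; exact hα3
  have hα2' : 2 * (α / (L : ℝ) ^ 2 * (L : ℝ) ^ 2) ≤ c2' d L := by rw [hdiv]; exact hα2
  have h17 : pdev U < α / (L : ℝ) ^ 2 * (L : ℝ) ^ 2 * (((L : ℝ) ^ k)⁻¹) ^ 2 := by rwa [hdiv]
  have h128 := fun m hm => ineq128_global L hL hG k U hU hβ hα3' hα2' h17 m hm
  have hmemG := (h128 0 (Nat.zero_le k)).2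
  have hmem : ∀ j ≤ k, ∀ x μ, avgIter L U j x μ ∈ U1 𝔸 := fun j hj x μ =>
    hG.le_U1 (hmemG j (by simpa using hj) x μ)
  have hS := geom_sum_le hL k
  have htot : ∑ m ∈ Finset.range k, 4 * (d : ℝ) ^ 2 * (L : ℝ) ^ 2 * aLev (α / (L : ℝ) ^ 2) L (m + 1) ≤ 1 / 6 := by
    rw [descent_sum_eq_printed hL1]
    have := mul_le_mul_of_nonneg_left hS (by positivity : (0 : ℝ) ≤ 8 * (d : ℝ) ^ 2 * α)
    nlinarith
  have ha : ∀ m, 1 ≤ m → m ≤ k → 0 < aLev (α / (L : ℝ) ^ 2) L m ∧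
      aLev (α / (L : ℝ) ^ 2) L m * (L : ℝ) ^ 2 ≤ 1 / (6 * ((d : ℝ) + 1)) := fun m hm1 _ =>
    ⟨by unfold aLev; positivity,
      (aLev_mul_sq_le hL1 hβ.le hm1).trans (by rw [hdiv]; exact two_mul_le_of_C0 hα.le hα3)⟩
  have h := norm_avg_sub_pull_le hL1 hd lo hi U k (aLev (α / (L : ℝ) ^ 2) L) hmem
    (fun m _ hmk => plaqSmall_of_pdev (hmem _ (by omega)) (h128 m hmk).1.le _ _) h15 ha htot n hn x ν hx hxν
  rw [descent_sum_eq_printed hL1] at h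
  obtain ⟨hm1, hm2⟩ := ineq165_members hL hd hα n
  exact ⟨h, hm1.trans_lt hm2⟩

end FirstInput

/-! ## §4 *"This and (1.83) imply |M^j(U₀) − 1| < O(1)B₃B₅M⁶ε_k inside Λ. (1.84)"* -/

section Ineq184

variable {𝔸 : Type*} [NormedRing 𝔸] [NormOneClass 𝔸] [NormedAlgebra ℂ 𝔸] [CompleteSpace 𝔸]

omit [NormedAlgebra ℂ 𝔸] [CompleteSpace 𝔸] in
/-- **(1.83) for `V_Λ` itself** when it is already in the axial gauge of `Λ^{(k)}` rooted at the corner `lo`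
(`V_Λ(Γ_{lo,x}) = 1`, `x ∈ Λ^{(k)}`): then `V_Λ^{ax} = V_Λ` on the box and the generation-5 bound
`B15Ineq183AxialGauge.Hyp183.norm_axial_bond_sub_one_le` reads `|V_Λ(b) − 1| ≤ (d − 1)·D·a₀` for `b ⊂ Λ^{(k)}`.
[cite: Balaban1989LargeFieldI, (1.83) p.197] -/
theorem norm_top_bond_sub_one_le {V : Site d → Fin d → 𝔸ˣ} {lo hi : Site d} {D : ℕ} {a₀ : ℝ}
    (H : B15Ineq183AxialGauge.Hyp183 V lo hi D a₀) (hgax : ∀ x, lo ≤ x → x ≤ hi → axialFn V lo x = 1)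
    {x : Site d} {ν : Fin d} (hx : lo ≤ x) (hxν : x + e ν ≤ hi) :
    ‖((V x ν : 𝔸ˣ) : 𝔸) - 1‖ ≤ ((d - 1 : ℕ) : ℝ) * D * a₀ := by
  have h := H.norm_axial_bond_sub_one_le hx hxν
  have hx' : x ≤ hi := le_of_add_e_le hxν
  have hxν' : lo ≤ x + e ν := hx.trans (le_add_of_nonneg_right (e_nonneg ν))
  simp only [gaugeAct, hgax x hx hx', hgax (x + e ν) hxν' hxν, one_mul, inv_one, mul_one] at h
  exact h

/-- **(1.84), EXPLICIT FORM** — *"This and (1.83) imply |M^j(U₀) − 1| < O(1)B₃B₅M⁶ε_k inside Λ"*: under the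
hypotheses of `norm_avg_sub_pull_lt` ((1.80) inside `Λ` as `|U₀(∂p) − 1| < αη²`, the axial gauge in `k`-blocks),
the regularity (1.78) of `V_Λ = M^k(U₀)` on `Λ^{(k)} = [lo, hi]` (`|V_Λ(∂p′) − 1| ≤ a₀`, at most `D + 1` sites per
direction) and the axial gauge of `V_Λ` in `Λ^{(k)}`, every bond `b ⊂ Λ^{(j)}`, `j = k − n`, satisfies
`|M^j(U₀)(b) − 1| < 11d²α + (d − 1)·D·a₀` (the triangle inequality through `Q^{s*}_{k−j}V_Λ`, whose bond variables are
`1` or top-level bond variables `V_Λ(c)`, `norm_pullIter_sub_one_le`). [cite: Balaban1989LargeFieldI, (1.84) p.197] -/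
theorem ineq184_explicit (L : ℕ) (hL : 2 ≤ L) (hd : 1 ≤ d) {G : Subgroup 𝔸ˣ} (hG : AvgClosed d L G) (k : ℕ)
    (U : Site d → Fin d → 𝔸ˣ) (hU : ∀ x κ, U x κ ∈ G) {α : ℝ} (hα : 0 < α) (hα3 : C0 d * α ≤ 1 / 3)
    (hα2 : 2 * α ≤ c2' d L) (hαs : 11 * (d : ℝ) ^ 2 * α ≤ 1 / 6)
    (h180 : pdev U < α * (((L : ℝ) ^ k)⁻¹) ^ 2) (lo hi : Site d)
    (h15 : ∀ n, n < k → ∀ z, tlo L lo n ≤ z → z ≤ thi L hi n → ∀ r : Fin d → Fin L,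
      axialFn (avgIter L U (k - (n + 1))) ((L : ℤ) • z) ((L : ℤ) • z + boxVec L r) = 1)
    {D : ℕ} {a₀ : ℝ} (H : B15Ineq183AxialGauge.Hyp183 (avgIter L U k) lo hi D a₀)
    (hgax : ∀ x, lo ≤ x → x ≤ hi → axialFn (avgIter L U k) lo x = 1)
    (n : ℕ) (hn : n ≤ k) (x : Site d) (ν : Fin d) (hx : tlo L lo n ≤ x) (hxν : x + e ν ≤ thi L hi n) :
    ‖((avgIter L U (k - n) x ν : 𝔸ˣ) : 𝔸) - 1‖ < 11 * (d : ℝ) ^ 2 * α + ((d - 1 : ℕ) : ℝ) * D * a₀ := by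
  have hL1 : 1 ≤ L := le_trans (by norm_num) hL
  obtain ⟨h1, h2⟩ := norm_avg_sub_pull_lt L hL hd hG k U hU hα hα3 hα2 hαs h180 lo hi h15 n hn x ν hx hxν
  have hB : 0 ≤ ((d - 1 : ℕ) : ℝ) * D * a₀ := by have := H.nonneg; positivity
  have h3 := norm_pullIter_sub_one_le hL1 lo hi (avgIter L U k) hB
    (fun x ν hx hxν => norm_top_bond_sub_one_le H hgax hx hxν) n x ν hx hxν
  have htri : ‖((avgIter L U (k - n) x ν : 𝔸ˣ) : 𝔸) - 1‖ ≤
      ‖((avgIter L U (k - n) x ν : 𝔸ˣ) : 𝔸) - pullIter L (avgIter L U k) n x ν‖ +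
        ‖((pullIter L (avgIter L U k) n x ν : 𝔸ˣ) : 𝔸) - 1‖ := by
    have : ((avgIter L U (k - n) x ν : 𝔸ˣ) : 𝔸) - 1 =
        (((avgIter L U (k - n) x ν : 𝔸ˣ) : 𝔸) - pullIter L (avgIter L U k) n x ν) +
          (((pullIter L (avgIter L U k) n x ν : 𝔸ˣ) : 𝔸) - 1) := by abel
    rw [this]; exact norm_add_le _ _
  linarith

/-- **(1.84) BY NAME** — the typed leaf `B15.BasicStep.Ineq184 |M^j(U₀)(b) − 1| (11d²K + 100dK₅) B₃ B₅ M ε_k`, i.e.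
*"|M^j(U₀) − 1| < O(1)B₃B₅M⁶ε_k inside Λ"* with `O(1) = 11d²K + 100dK₅`, for every bond `b ⊂ Λ^{(j)}`, `j = k − n`,
from: (1.80) inside `Λ` with `α ≤ K·B₃B₅M⁵ε_k`, the axial gauge in `k`-blocks, (1.78) for `V_Λ = M^k(U₀)` on
`Λ^{(k)}` with `a₀ ≤ K₅·B₅M⁵ε_k` in a cube of size `100M` (`D ≤ 100M`), and the axial gauge of `V_Λ` in `Λ^{(k)}` —
the generation-5 inference `B15Ineq183AxialGauge.ineq184_of_inputs` with BOTH inputs now derived: the first by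
`norm_avg_sub_pull_lt` (`< 11d²·K·B₃B₅M⁵ε_k`), the second (1.83) for the bond variables of `Q^{s*}_{k−j}V_Λ` by
`B15Ineq183AxialGauge.ineq183_of_le`. [cite: Balaban1989LargeFieldI, (1.84) p.197] -/
theorem ineq184 (L : ℕ) (hL : 2 ≤ L) (hd : 1 ≤ d) {G : Subgroup 𝔸ˣ} (hG : AvgClosed d L G) (k : ℕ)
    (U : Site d → Fin d → 𝔸ˣ) (hU : ∀ x κ, U x κ ∈ G) {α : ℝ} (hα : 0 < α) (hα3 : C0 d * α ≤ 1 / 3)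
    (hα2 : 2 * α ≤ c2' d L) (hαs : 11 * (d : ℝ) ^ 2 * α ≤ 1 / 6)
    (h180 : pdev U < α * (((L : ℝ) ^ k)⁻¹) ^ 2) (lo hi : Site d)
    (h15 : ∀ n, n < k → ∀ z, tlo L lo n ≤ z → z ≤ thi L hi n → ∀ r : Fin d → Fin L,
      axialFn (avgIter L U (k - (n + 1))) ((L : ℤ) • z) ((L : ℤ) • z + boxVec L r) = 1)
    {D : ℕ} {a₀ : ℝ} (H : B15Ineq183AxialGauge.Hyp183 (avgIter L U k) lo hi D a₀)
    (hgax : ∀ x, lo ≤ x → x ≤ hi → axialFn (avgIter L U k) lo x = 1)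
    {K K₅ B₃ B₅ M εk : ℝ} (hK : 0 < K) (hK₅ : 0 < K₅) (hB₃ : 1 ≤ B₃) (hB₅ : 0 < B₅) (hM : 1 ≤ M)
    (hεk : 0 < εk) (hαK : α ≤ K * B₃ * B₅ * M ^ 5 * εk) (ha₀ : a₀ ≤ K₅ * B₅ * M ^ 5 * εk)
    (hD : (D : ℝ) ≤ 100 * M)
    (n : ℕ) (hn : n ≤ k) (x : Site d) (ν : Fin d) (hx : tlo L lo n ≤ x) (hxν : x + e ν ≤ thi L hi n) :
    B15.BasicStep.Ineq184 ‖((avgIter L U (k - n) x ν : 𝔸ˣ) : 𝔸) - 1‖ (11 * (d : ℝ) ^ 2 * K + 100 * d * K₅)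
      B₃ B₅ M εk := by
  have hL1 : 1 ≤ L := le_trans (by norm_num) hL
  have hM0 : 0 < M := by linarith
  set Q : 𝔸 := ((pullIter L (avgIter L U k) n x ν : 𝔸ˣ) : 𝔸) with hQ
  -- first input: `|M^j(U₀)(b) − (Q^{s*}V_Λ)(b)| < 11d²·K·B₃B₅M⁵ε_k`
  obtain ⟨h1, h2⟩ := norm_avg_sub_pull_lt L hL hd hG k U hU hα hα3 hα2 hαs h180 lo hi h15 n hn x ν hx hxν
  have hfirst : ‖((avgIter L U (k - n) x ν : 𝔸ˣ) : 𝔸) - Q‖ < 11 * (d : ℝ) ^ 2 * K * B₃ * B₅ * M ^ 5 * εk := by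
    have hd2 : (0 : ℝ) ≤ 11 * (d : ℝ) ^ 2 := by positivity
    have := mul_le_mul_of_nonneg_left hαK hd2
    calc ‖((avgIter L U (k - n) x ν : 𝔸ˣ) : 𝔸) - Q‖ < 11 * (d : ℝ) ^ 2 * α := h1.trans_lt h2
      _ ≤ 11 * (d : ℝ) ^ 2 * (K * B₃ * B₅ * M ^ 5 * εk) := this
      _ = 11 * (d : ℝ) ^ 2 * K * B₃ * B₅ * M ^ 5 * εk := by ring
  -- second input: (1.83) for the bond variable `Q ∈ {1} ∪ {V_Λ(c)}`
  have hB : 0 ≤ ((d - 1 : ℕ) : ℝ) * D * a₀ := by have := H.nonneg; positivity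
  have hsecond' : ‖Q - 1‖ ≤ ((d - 1 : ℕ) : ℝ) * D * a₀ :=
    norm_pullIter_sub_one_le hL1 lo hi (avgIter L U k) hB
      (fun x ν hx hxν => norm_top_bond_sub_one_le H hgax hx hxν) n x ν hx hxν
  have hsecond : B15.BasicStep.Ineq183 ‖Q - 1‖ (100 * d * K₅) B₅ M εk :=
    B15Ineq183AxialGauge.ineq183_of_le hsecond' (by omega) H.nonneg hK₅ hB₅ hM0 hεk hD ha₀
  have h := B15Ineq183AxialGauge.ineq184_of_inputs (d := d) hfirst hsecond (by positivity) hB₃ hB₅.le hM hεk.le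
    hK.le
  exact h

end Ineq184


/-! ## §5 (1.84) FOR EVERY ORBIT: the gauge exists (`B8Eq115GaugeFixing.gaugeFix_global`) -/

section Orbit

variable {𝔸 : Type*} [NormedRing 𝔸] [NormOneClass 𝔸] [NormedAlgebra ℂ 𝔸] [CompleteSpace 𝔸]

/-- **(1.84) FOR EVERY ORBIT** — *"Consider the configuration U₀ inside the domain Λ. We take it in the axial gauge
in k-blocks … We fix for it [V_Λ = M_k(U₀)] the axial gauge in Λ^{(k)}"*: for EVERY `G`-valued `U₀` (gauge
hypotheses removed) satisfying (1.80) inside `Λ` (`|U₀(∂p) − 1| < αη²`, `α ≤ K·B₃B₅M⁵ε_k`, gauge invariant) and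
(1.78) for `M^k(U₀)` on `Λ^{(k)} = [lo, hi]` (`a₀ ≤ K₅·B₅M⁵ε_k`, gauge invariant, `D ≤ 100M`), the gauge-fixed
representative `U₀′ = U₀^{u}`, `u = B8Eq115GaugeFixing.towerGauge L U₀ k lo` (which EXISTS by
`B8Eq115GaugeFixing.gaugeFix_global`: (1.15) in all blocks at all levels and `M^k(U₀′)(Γ_{lo,x}) = 1`), satisfies
the typed leaf `B15.BasicStep.Ineq184 |M^j(U₀′)(b) − 1| (11d²K + 100dK₅) B₃ B₅ M ε_k` on every bond `b ⊂ Λ^{(j)}`,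
`j = k − n`. [cite: Balaban1989LargeFieldI, (1.84) p.197] -/
theorem ineq184_orbit (L : ℕ) (hL : 2 ≤ L) (hd : 1 ≤ d) {G : Subgroup 𝔸ˣ} (hG : AvgClosed d L G) (k : ℕ)
    (U : Site d → Fin d → 𝔸ˣ) (hU : ∀ x κ, U x κ ∈ G) {α : ℝ} (hα : 0 < α) (hα3 : C0 d * α ≤ 1 / 3)
    (hα2 : 2 * α ≤ c2' d L) (hαs : 11 * (d : ℝ) ^ 2 * α ≤ 1 / 6)
    (h180 : pdev U < α * (((L : ℝ) ^ k)⁻¹) ^ 2) (lo hi : Site d) {D : ℕ} (hwidth : ∀ κ, hi κ ≤ lo κ + D)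
    {a₀ : ℝ} (ha₀0 : 0 ≤ a₀) (hreg : B8Lemma1NonAbelian.PlaqSmall (avgIter L U k) lo hi a₀)
    {K K₅ B₃ B₅ M εk : ℝ} (hK : 0 < K) (hK₅ : 0 < K₅) (hB₃ : 1 ≤ B₃) (hB₅ : 0 < B₅) (hM : 1 ≤ M)
    (hεk : 0 < εk) (hαK : α ≤ K * B₃ * B₅ * M ^ 5 * εk) (ha₀ : a₀ ≤ K₅ * B₅ * M ^ 5 * εk)
    (hD : (D : ℝ) ≤ 100 * M)
    (n : ℕ) (hn : n ≤ k) (x : Site d) (ν : Fin d) (hx : tlo L lo n ≤ x) (hxν : x + e ν ≤ thi L hi n) :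
    B15.BasicStep.Ineq184
      ‖((avgIter L (gaugeAct (towerGauge L U k lo) U) (k - n) x ν : 𝔸ˣ) : 𝔸) - 1‖
      (11 * (d : ℝ) ^ 2 * K + 100 * d * K₅) B₃ B₅ M εk := by
  have hL' : (0 : ℝ) < L := by exact_mod_cast lt_of_lt_of_le (by norm_num) hL
  have hdiv : α / (L : ℝ) ^ 2 * (L : ℝ) ^ 2 = α := div_mul_cancel₀ _ (pow_ne_zero 2 hL'.ne')
  have hβ : 0 < α / (L : ℝ) ^ 2 := by positivity
  have hα3' : C0 d * (α / (L : ℝ) ^ 2 * (L : ℝ) ^ 2) ≤ 1 / 3 := by rw [hdiv]; exact hα3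
  have hα2' : 2 * (α / (L : ℝ) ^ 2 * (L : ℝ) ^ 2) ≤ c2' d L := by rw [hdiv]; exact hα2
  have h17 : pdev U < α / (L : ℝ) ^ 2 * (L : ℝ) ^ 2 * (((L : ℝ) ^ k)⁻¹) ^ 2 := by rwa [hdiv]
  obtain ⟨huG, hU'G, hpdev, hcov, h15, htop⟩ := gaugeFix_global L hL hG k U hU hβ hα3' hα2' h17 lo
  set U' := gaugeAct (towerGauge L U k lo) U with hU'
  have h180' : pdev U' < α * (((L : ℝ) ^ k)⁻¹) ^ 2 := by rw [hpdev]; exact h180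
  have h17' : pdev U' < α / (L : ℝ) ^ 2 * (L : ℝ) ^ 2 * (((L : ℝ) ^ k)⁻¹) ^ 2 := by rwa [hdiv]
  have hmemG := (ineq128_global L hL hG k U' hU'G hβ hα3' hα2' h17' 0 (Nat.zero_le k)).2
  have hw : ∀ x, uLev L (towerGauge L U k lo) k x ∈ U1 𝔸 := fun x => by
    rw [uLev_apply]; exact hG.le_U1 (huG _)
  have H : B15Ineq183AxialGauge.Hyp183 (avgIter L U' k) lo hi D a₀ :=
    ⟨fun x κ => hG.le_U1 (hmemG k (by simp) x κ), hwidth,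
      fun x κ μ hκμ hx hx' => by
        rw [hcov k le_rfl, norm_hol_gaugeAct_plaqWord hw]; exact hreg x κ μ hκμ hx hx',
      ha₀0⟩
  exact ineq184 L hL hd hG k U' hU'G hα hα3 hα2 hαs h180' lo hi (fun n hn z _ _ r => h15 n hn z r) H
    (fun x _ _ => htop x) hK hK₅ hB₃ hB₅ hM hεk hαK ha₀ hD n hn x ν hx hxν

end Orbit

end Literature.MathematicalPhysics.QuantumFieldTheory.Balaban1983to89.B15Ineq184BlockAxial
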